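import Summits.RiemannHypothesis.RiemannHypothesis.Theorems.Splittings.LinearRayCuspDeriv
import Summits.RiemannHypothesis.RiemannHypothesis.Theorems.LaplaceLoophole.Negative.LaplaceLoopholeThetaCertificate

/-!
# Linear ray, cusp transformation II — `Φ_ℂ(iy) = e^{9iy}F₂(e^{4iy}) + (3/2)e^{5iy}F₁(e^{4iy})` and the cusp algebra
(part 2 of 4) The tree's `UniversalFactor.PhiICert.term` summed over `m ≥ 1` equals `e^{9iy} F 2 (e^{4iy}) + (3/2) e^{5iy} F 1 (e^{4iy})`
(`tsum_term_eq`); at `y = π/8 − ε`: `e^{4iy} − i = 2 sin(2ε)·e^{−2iε}`, `(e^{4iy} − i)⁻¹ = ½cot 2ε + i/2`; principal powers and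
norms of `s·e^{iθ}`.
HONEST LABEL: a refutation of an RH-STRENGTHENING conjunct (the linear-factor ray); RH-free; nothing here bears on the truth of RH.
Provenance: rh-splitx-eng-5 g2 (cell rh-split, D-0116 arm; C15 / S-dbn-1 filler → kernel), monolith HOME/rh-splitx-eng-5/dbn/LinearRayCusp.lean; references: C. G. J. Jacobi (imaginary transformation of ϑ), B. Riemann / E. C. Titchmarsh §10.1 (Φ and Ξ), N. G. de Bruijn, Duke Math. J. 17 (1950) (Φ as analytic kernel).

FILING DELTA (lead RULING #49, flag F1, lean/CONVENTIONS.md §2): outer namespace `Summit.RiemannHypothesis.RiemannHypothesis.Theorems.Splittings.LinearRayCusp` added — `CuspTransform` is nested inside it (namespace/`open` lines only; decl text unchanged).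
-/

noncomputable section

set_option linter.dupNamespace false

open Complex Real Set Filter Topology

namespace Summit.RiemannHypothesis.RiemannHypothesis.Theorems.Splittings.LinearRayCusp

namespace CuspTransform
/-! ## Stage C: `Φ_ℂ(iy) = e^{9iy} F₂(e^{4iy}) + (3/2) e^{5iy} F₁(e^{4iy})` -/

/-- The integer family is summable at every `x` with `Re x > 0`. -/
theorem summable_eterm_F (k : ℕ) {x : ℂ} (hx : 0 < x.re) :
    Summable fun n : ℤ => eterm ((n : ℝ) ^ 2) k x := by
  have hδ : 0 < x.re / 2 := by linarith
  refine Summable.of_norm_bounded (summable_F_majorant hδ k) fun n => ?_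
  exact norm_eterm_le _ (sq_nonneg _) k (show x.re / 2 < x.re by linarith)

/-- The `ℕ`-indexed (shifted) integer family is summable for `Re x > 0`. -/
theorem summable_eterm_nat (k : ℕ) {x : ℂ} (hx : 0 < x.re) :
    Summable fun n : ℕ => eterm (((n : ℝ) + 1) ^ 2) k x := by
  have h := (summable_eterm_F k hx).comp_injective (i := fun n : ℕ => (n : ℤ) + 1)
    (fun a b h => by simpa using h)
  refine h.congr fun n => ?_
  simp only [Function.comp_apply, Int.cast_add, Int.cast_natCast, Int.cast_one]

/-- For `k ≥ 1`: `F k x = 2 Σ_{m≥1} (−πm²)^k e^{−πm²x}` (even series, vanishing `n = 0` term). -/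
theorem F_eq_two_mul_tsum_nat (k : ℕ) (hk : k ≠ 0) {x : ℂ} (hx : 0 < x.re) :
    F k x = 2 * ∑' n : ℕ, eterm (((n : ℝ) + 1) ^ 2) k x := by
  have hs := summable_eterm_F k hx
  set f : ℤ → ℂ := fun m => eterm ((m : ℝ) ^ 2) k x with hf
  have h1 : Summable fun n : ℕ => f ((n : ℤ) + 1) :=
    hs.comp_injective (i := fun n : ℕ => (n : ℤ) + 1) (fun a b h => by simpa using h)
  have h2 : Summable fun n : ℕ => f (-((n : ℤ) + 1)) :=
    hs.comp_injective (i := fun n : ℕ => -((n : ℤ) + 1)) (fun a b h => by simpa using h)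
  have hF : F k x = ∑' n : ℤ, f n := rfl
  rw [hF, tsum_of_add_one_of_neg_add_one h1 h2]
  have e0 : f 0 = 0 := by
    simp only [hf, eterm, Int.cast_zero]
    rw [sq, mul_zero, Complex.ofReal_zero, mul_zero, zero_pow hk, zero_mul]
  have e1 : ∑' n : ℕ, f ((n : ℤ) + 1) = ∑' n : ℕ, eterm (((n : ℝ) + 1) ^ 2) k x :=
    tsum_congr fun n => by simp only [hf]; push_cast; ring_nf
  have e2 : ∑' n : ℕ, f (-((n : ℤ) + 1)) = ∑' n : ℕ, eterm (((n : ℝ) + 1) ^ 2) k x :=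
    tsum_congr fun n => by simp only [hf]; push_cast; ring_nf
  rw [e0, e1, e2]
  ring

open Summit.RiemannHypothesis.RiemannHypothesis.Theorems.UniversalFactor in
/-- termwise form of the tree's `PhiICert.term`. -/
theorem term_succ_eq_eterm (n : ℕ) (y : ℝ) :
    PhiICert.term (n + 1) y =
      cexp (9 * (I * y)) * (2 * eterm (((n : ℝ) + 1) ^ 2) 2 (cexp (4 * (I * y)))) +
        3 / 2 * cexp (5 * (I * y)) * (2 * eterm (((n : ℝ) + 1) ^ 2) 1 (cexp (4 * (I * y)))) := by
  unfold PhiICert.term eterm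
  push_cast
  ring_nf

/-- `Re e^{4iy} = cos 4y`. -/
theorem re_cexp_four_I (y : ℝ) : (cexp (4 * (I * y))).re = Real.cos (4 * y) := by
  rw [show (4 * (I * (y : ℂ))) = ((4 * y : ℝ) : ℂ) * I by push_cast; ring, Complex.exp_ofReal_mul_I_re]

/-- `Re e^{4iy} > 0` for `|y| < π/8`. -/
theorem re_cexp_four_I_pos {y : ℝ} (hy : |y| < π / 8) : 0 < (cexp (4 * (I * y))).re := by
  rw [re_cexp_four_I]
  apply Real.cos_pos_of_mem_Ioo
  constructor <;> [have := (abs_lt.1 hy).1; have := (abs_lt.1 hy).2] <;> linarith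

open Summit.RiemannHypothesis.RiemannHypothesis.Theorems.UniversalFactor in
/-- **Stage C**: `Σ_{m≥1} s_m(y) = e^{9iy}F₂(e^{4iy}) + (3/2)e^{5iy}F₁(e^{4iy})` for `|y| < π/8`. -/
theorem tsum_term_eq {y : ℝ} (hy : |y| < π / 8) :
    ∑' n : ℕ, PhiICert.term (n + 1) y =
      cexp (9 * (I * y)) * F 2 (cexp (4 * (I * y))) + 3 / 2 * cexp (5 * (I * y)) * F 1 (cexp (4 * (I * y))) := by
  have hx := re_cexp_four_I_pos hy
  set x := cexp (4 * (I * y)) with hxdef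
  have s2 := summable_eterm_nat 2 hx
  have s1 := summable_eterm_nat 1 hx
  have hA : Summable fun n : ℕ => cexp (9 * (I * y)) * (2 * eterm (((n : ℝ) + 1) ^ 2) 2 x) :=
    (s2.mul_left 2).mul_left _
  have hB : Summable fun n : ℕ => 3 / 2 * cexp (5 * (I * y)) * (2 * eterm (((n : ℝ) + 1) ^ 2) 1 x) :=
    (s1.mul_left 2).mul_left _
  have A : ∑' n : ℕ, cexp (9 * (I * y)) * (2 * eterm (((n : ℝ) + 1) ^ 2) 2 x) =
      cexp (9 * (I * y)) * (2 * ∑' n : ℕ, eterm (((n : ℝ) + 1) ^ 2) 2 x) := by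
    rw [tsum_mul_left, s2.tsum_mul_left]
  have B : ∑' n : ℕ, 3 / 2 * cexp (5 * (I * y)) * (2 * eterm (((n : ℝ) + 1) ^ 2) 1 x) =
      3 / 2 * cexp (5 * (I * y)) * (2 * ∑' n : ℕ, eterm (((n : ℝ) + 1) ^ 2) 1 x) := by
    rw [tsum_mul_left, s1.tsum_mul_left]
  rw [F_eq_two_mul_tsum_nat 2 (by norm_num) hx, F_eq_two_mul_tsum_nat 1 (by norm_num) hx]
  simp_rw [term_succ_eq_eterm, ← hxdef]
  rw [hA.tsum_add hB, A, B]

/-! ## Stage A: cusp algebra at `x₀ = e^{4iy}`, `y = π/8 − ε` -/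

/-- `e^{4iy} − i = 2 sin(2ε) · e^{−2iε}` for `y = π/8 − ε`. -/
theorem cexp_four_I_sub_I (ε : ℝ) :
    cexp (4 * (I * ((π / 8 - ε : ℝ) : ℂ))) - I =
      ((2 * Real.sin (2 * ε) : ℝ) : ℂ) * cexp (((-(2 * ε) : ℝ) : ℂ) * I) := by
  have h1 : (4 * (I * ((π / 8 - ε : ℝ) : ℂ))) = ((π / 2 - 4 * ε : ℝ) : ℂ) * I := by push_cast; ring
  rw [h1, Complex.exp_mul_I, Complex.exp_mul_I]
  have hc : Complex.cos ((π / 2 - 4 * ε : ℝ) : ℂ) = (Real.sin (4 * ε) : ℝ) := by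
    rw [← Complex.ofReal_cos, Real.cos_pi_div_two_sub]
  have hs : Complex.sin ((π / 2 - 4 * ε : ℝ) : ℂ) = (Real.cos (4 * ε) : ℝ) := by
    rw [← Complex.ofReal_sin, Real.sin_pi_div_two_sub]
  have hc2 : Complex.cos ((-(2 * ε) : ℝ) : ℂ) = (Real.cos (2 * ε) : ℝ) := by
    rw [← Complex.ofReal_cos, Real.cos_neg]
  have hs2 : Complex.sin ((-(2 * ε) : ℝ) : ℂ) = (-Real.sin (2 * ε) : ℝ) := by
    rw [← Complex.ofReal_sin, Real.sin_neg]
  rw [hc, hs, hc2, hs2]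
  have h4s : Real.sin (4 * ε) = 2 * Real.sin (2 * ε) * Real.cos (2 * ε) := by
    rw [show (4 : ℝ) * ε = 2 * (2 * ε) by ring, Real.sin_two_mul]
  have h4c : Real.cos (4 * ε) = 1 - 2 * Real.sin (2 * ε) ^ 2 := by
    rw [show (4 : ℝ) * ε = 2 * (2 * ε) by ring, Real.cos_two_mul, Real.cos_sq']; ring
  rw [h4s, h4c]
  push_cast
  ring_nf

/-- `(e^{4iy} − i)⁻¹ = ½cot(2ε) + i/2` for `y = π/8 − ε`, `sin 2ε ≠ 0`. -/
theorem inv_cexp_four_I_sub_I {ε : ℝ} (hε : Real.sin (2 * ε) ≠ 0) :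
    (cexp (4 * (I * ((π / 8 - ε : ℝ) : ℂ))) - I)⁻¹ =
      ((Real.cos (2 * ε) / (2 * Real.sin (2 * ε)) : ℝ) : ℂ) + ((1 / 2 : ℝ) : ℂ) * I := by
  rw [cexp_four_I_sub_I, mul_inv, ← Complex.exp_neg]
  have e : cexp (-((((-(2 * ε) : ℝ) : ℂ)) * I)) = (Real.cos (2 * ε) : ℂ) + (Real.sin (2 * ε) : ℂ) * I := by
    rw [show -((((-(2 * ε) : ℝ) : ℂ)) * I) = ((2 * ε : ℝ) : ℂ) * I by push_cast; ring, Complex.exp_mul_I,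
      ← Complex.ofReal_cos, ← Complex.ofReal_sin]
  rw [e, ← Complex.ofReal_inv]
  apply Complex.ext
  · simp only [Complex.mul_re, Complex.add_re, Complex.add_im, Complex.mul_im, Complex.ofReal_re, Complex.ofReal_im,
      Complex.I_re, Complex.I_im, mul_zero, mul_one, zero_mul, sub_zero, add_zero, zero_add]
    field_simp
  · simp only [Complex.mul_re, Complex.add_re, Complex.add_im, Complex.mul_im, Complex.ofReal_re, Complex.ofReal_im,
      Complex.I_re, Complex.I_im, mul_zero, mul_one, zero_mul, sub_zero, add_zero, zero_add]
    field_simp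

/-- Principal power of `s·e^{iθ}` for `s > 0`, `θ ∈ (−π, π]`, real exponent `p`:
`(s e^{iθ})^p = s^p · e^{ipθ}`. -/
theorem ofReal_mul_cexp_cpow {s θ p : ℝ} (hs : 0 < s) (hθ1 : -π < θ) (hθ2 : θ ≤ π) :
    (((s : ℝ) : ℂ) * cexp ((θ : ℂ) * I)) ^ ((p : ℝ) : ℂ) = ((s ^ p : ℝ) : ℂ) * cexp (((p * θ : ℝ) : ℂ) * I) := by
  have hz : ((s : ℂ)) * cexp ((θ : ℂ) * I) = cexp ((Real.log s : ℂ) + (θ : ℂ) * I) := by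
    rw [Complex.exp_add, ← Complex.ofReal_exp, Real.exp_log hs]
  have hne : ((s : ℂ)) * cexp ((θ : ℂ) * I) ≠ 0 := by
    rw [hz]; exact Complex.exp_ne_zero _
  rw [Complex.cpow_def_of_ne_zero hne, hz, Complex.log_exp]
  · rw [show ((Real.log s : ℂ) + (θ : ℂ) * I) * ((p : ℝ) : ℂ) = ((p * Real.log s : ℝ) : ℂ) + ((p * θ : ℝ) : ℂ) * I by
      push_cast; ring, Complex.exp_add, ← Complex.ofReal_exp, Real.rpow_def_of_pos hs, mul_comm (Real.log s)]
  · simp only [Complex.add_im, Complex.ofReal_im, Complex.mul_im, Complex.ofReal_re, Complex.I_im, Complex.I_re,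
      mul_zero, mul_one, zero_add, add_zero]; linarith
  · simp only [Complex.add_im, Complex.ofReal_im, Complex.mul_im, Complex.ofReal_re, Complex.I_im, Complex.I_re,
      mul_zero, mul_one, zero_add, add_zero]; exact hθ2

/-- Norm of the same power: `‖(s e^{iθ})^p‖ = s^p`. -/
theorem norm_ofReal_mul_cexp_cpow {s θ p : ℝ} (hs : 0 < s) (hθ1 : -π < θ) (hθ2 : θ ≤ π) :
    ‖(((s : ℝ) : ℂ) * cexp ((θ : ℂ) * I)) ^ ((p : ℝ) : ℂ)‖ = s ^ p := by
  rw [ofReal_mul_cexp_cpow hs hθ1 hθ2, norm_mul, Complex.norm_exp_ofReal_mul_I, mul_one, Complex.norm_real,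
    Real.norm_of_nonneg (Real.rpow_nonneg hs.le p)]

end CuspTransform

end Summit.RiemannHypothesis.RiemannHypothesis.Theorems.Splittings.LinearRayCusp

end
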